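import Summits.ValiantsHypothesis.ValiantsHypothesis.Theorems.LacunarySymmetroidMatrixDescartesCensusAtomM6K4QF53
import Summits.ValiantsHypothesis.ValiantsHypothesis.Theorems.LacunarySymmetroidMatrixDescartesCensusAtomM6K5EB75
import Summits.ValiantsHypothesis.ValiantsHypothesis.Theorems.LacunarySymmetroidMatrixDescartesCensusAtomM6K4QF55
import Summits.ValiantsHypothesis.ValiantsHypothesis.Theorems.LacunarySymmetroidMatrixDescartesCensusAtomM6K5EB80

/-!
# `MatrixDescartes` census — MIXED JUNCTION ROWS at `m = 6` from the atom blocks (block words, one line each)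

HONEST FRAMING.  Experiment cell `val-V1-extremal`, width seat val-v1x-eng-8 g3 (`mixgen.py`).  Each theorem below is a census LOWER bound
`¬ PosRootLawAt 6 K (N − 1)` («some real symmetric `K`-letter `6 × 6` lacunary pencil has `N` distinct positive determinant roots»)
obtained from kernel-certified ATOM BLOCKS of this cell (files `…CensusAtom*`: alternation certificate + Sylvester forms of the end letters,
all checked by the kernel) by the tree's JUNCTION LAW for matching junction inertia (`Chain.chain_append`, `…ChainInertia` /
`…ChainBlocks`, seat val-sym-mdr-p1) — alternation counts ADD, letter counts add minus one per junction — plus trailing grafts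
(`+6` per added letter, `Reflect.not_posRootLawAt_of_certificateT_add`).  `ʳ` = block reversed (`x ↦ 1/x`, `Reflect.block_reverse`),
`⁻` = all letters negated (`blockNeg`).  No explicit chained pencil is ever written: the kernel checks each atom once and the words here
are bookkeeping.  Rows: (6,7) ≥ 106 [M6K4QF53 ▹ M6K4QF53ʳ] (was 104); (6,8) ≥ 128 [M6K4QF53 ▹ M6K5EB75ʳ] (was 110); (6,10) ≥ 159 [M6K4QF53 ▹ M6K4QF53ʳ ▹ M6K4QF53] (was 156); (6,11) ≥ 181 [M6K5EB75 ▹ M6K4QF53ʳ ▹ M6K4QF53] (was 162); (6,12) ≥ 203 [M6K4QF53 ▹ M6K5EB75ʳ ▹ M6K5EB75] (was 171); (6,13) ≥ 225 [M6K5EB75 ▹ M6K5EB75ʳ ▹ M6K5EB75] (was 192).  CONSTRUCTION-FAMILY provenance (junctions of flags/caps/towers found by the cell's engine seats —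
credits in the atom files).  Nothing here bears on the asymptotic crux `Theses.LacunarySymmetroid.MatrixDescartes`
(stmt-ValiantsHypothesis-18050) nor on `VP ≠ VNP`; VP ≠ VNP is NOT proved.  Generated 2026-08-29T03:13Z.  [folklore]
-/

-- `Summit.ValiantsHypothesis.ValiantsHypothesis.…` repeats a component by the D-0017 layout
-- (single-conjunct summit), which the `dupNamespace` linter flags; the name is mandated.
set_option linter.dupNamespace false

namespace Summit.ValiantsHypothesis.ValiantsHypothesis.Theorems.LacunarySymmetroidMatrixDescartes.Census.Reflect.MixM6

open Summit.ValiantsHypothesis.ValiantsHypothesis.Theorems.MatrixDescartes.Negative (PosRootLawAt)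
open Summit.ValiantsHypothesis.ValiantsHypothesis.Theorems.LacunarySymmetroidMatrixDescartes.Census
open Summit.ValiantsHypothesis.ValiantsHypothesis.Theorems.LacunarySymmetroidMatrixDescartes.Census.Reflect

/-- **`ζ_sym(6,7) ≥ 106`** (`¬ PosRootLawAt 6 7 105`) — the block word `M6K4QF53 ▹ M6K4QF53ʳ` = `53 + 53` alternations on
`4 + 4 − 1` letters (junction law for matching junction inertia; kernel value before this file: 104). self-junction of QUADFLAG53 on its inertia-(3,3) flag letter (atoms by val-v1x-eng-2 g2 (quadric-seeded flags)). [folklore] -/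
theorem mix_6_7 : ¬ PosRootLawAt 6 7 105 := by
  have h := Chain.not_posRootLawAt_of_certificateT (by norm_num)
      (Chain.chain_append (by norm_num) (Chain.chain_of_block Reflect.AtomM6K4QF53.block)
        (block_reverse Reflect.AtomM6K4QF53.block) (Equiv.refl (Fin 6)) (by intro i; fin_cases i <;> norm_num))
  norm_num at h
  exact h

/-- **`ζ_sym(6,8) ≥ 128`** (`¬ PosRootLawAt 6 8 127`) — the block word `M6K4QF53 ▹ M6K5EB75ʳ` = `53 + 75` alternations on
`4 + 5 − 1` letters (junction law for matching junction inertia; kernel value before this file: 110). QUADFLAG53 ▹ ENDBOTH75 reversed, glued on the two (3,3) flag letters. [folklore] -/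
theorem mix_6_8 : ¬ PosRootLawAt 6 8 127 := by
  have h := Chain.not_posRootLawAt_of_certificateT (by norm_num)
      (Chain.chain_append (by norm_num) (Chain.chain_of_block Reflect.AtomM6K4QF53.block)
        (block_reverse Reflect.AtomM6K5EB75.block) (Equiv.refl (Fin 6)) (by intro i; fin_cases i <;> norm_num))
  norm_num at h
  exact h

/-- **`ζ_sym(6,10) ≥ 159`** (`¬ PosRootLawAt 6 10 158`) — the block word `M6K4QF53 ▹ M6K4QF53ʳ ▹ M6K4QF53` = `53 + 53 + 53` alternations on
`4 + 4 + 4 − 2` letters (junction law for matching junction inertia; kernel value before this file: 156). [folklore] -/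
theorem mix_6_10 : ¬ PosRootLawAt 6 10 158 := by
  have h := Chain.not_posRootLawAt_of_certificateT (by norm_num)
      (Chain.chain_append (by norm_num) (Chain.chain_append (by norm_num) (Chain.chain_of_block Reflect.AtomM6K4QF53.block)
        (block_reverse Reflect.AtomM6K4QF53.block) (Equiv.refl (Fin 6)) (by intro i; fin_cases i <;> norm_num))
        Reflect.AtomM6K4QF53.block (Equiv.refl (Fin 6)) (by intro i; fin_cases i <;> norm_num))
  norm_num at h
  exact h

/-- **`ζ_sym(6,11) ≥ 181`** (`¬ PosRootLawAt 6 11 180`) — the block word `M6K5EB75 ▹ M6K4QF53ʳ ▹ M6K4QF53` = `75 + 53 + 53` alternations on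
`5 + 4 + 4 − 2` letters (junction law for matching junction inertia; kernel value before this file: 162). [folklore] -/
theorem mix_6_11 : ¬ PosRootLawAt 6 11 180 := by
  have h := Chain.not_posRootLawAt_of_certificateT (by norm_num)
      (Chain.chain_append (by norm_num) (Chain.chain_append (by norm_num) (Chain.chain_of_block Reflect.AtomM6K5EB75.block)
        (block_reverse Reflect.AtomM6K4QF53.block) (Equiv.refl (Fin 6)) (by intro i; fin_cases i <;> norm_num))
        Reflect.AtomM6K4QF53.block (Equiv.refl (Fin 6)) (by intro i; fin_cases i <;> norm_num))
  norm_num at h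
  exact h

/-- **`ζ_sym(6,12) ≥ 203`** (`¬ PosRootLawAt 6 12 202`) — the block word `M6K4QF53 ▹ M6K5EB75ʳ ▹ M6K5EB75` = `53 + 75 + 75` alternations on
`4 + 5 + 5 − 2` letters (junction law for matching junction inertia; kernel value before this file: 171). [folklore] -/
theorem mix_6_12 : ¬ PosRootLawAt 6 12 202 := by
  have h := Chain.not_posRootLawAt_of_certificateT (by norm_num)
      (Chain.chain_append (by norm_num) (Chain.chain_append (by norm_num) (Chain.chain_of_block Reflect.AtomM6K4QF53.block)
        (block_reverse Reflect.AtomM6K5EB75.block) (Equiv.refl (Fin 6)) (by intro i; fin_cases i <;> norm_num))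
        Reflect.AtomM6K5EB75.block (Equiv.refl (Fin 6)) (by intro i; fin_cases i <;> norm_num))
  norm_num at h
  exact h

/-- **`ζ_sym(6,13) ≥ 225`** (`¬ PosRootLawAt 6 13 224`) — the block word `M6K5EB75 ▹ M6K5EB75ʳ ▹ M6K5EB75` = `75 + 75 + 75` alternations on
`5 + 5 + 5 − 2` letters (junction law for matching junction inertia; kernel value before this file: 192). [folklore] -/
theorem mix_6_13 : ¬ PosRootLawAt 6 13 224 := by
  have h := Chain.not_posRootLawAt_of_certificateT (by norm_num)
      (Chain.chain_append (by norm_num) (Chain.chain_append (by norm_num) (Chain.chain_of_block Reflect.AtomM6K5EB75.block)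
        (block_reverse Reflect.AtomM6K5EB75.block) (Equiv.refl (Fin 6)) (by intro i; fin_cases i <;> norm_num))
        Reflect.AtomM6K5EB75.block (Equiv.refl (Fin 6)) (by intro i; fin_cases i <;> norm_num))
  norm_num at h
  exact h

/-! ### Rows appended 2026-08-29T04:28Z (val-v1x-eng-8 g3): (6,7) ≥ 110 [M6K4QF55ʳ ▹ M6K4QF55] (was 106); (6,8) ≥ 135 [M6K4QF55 ▹ M6K5EB80] (was 128); (6,11) ≥ 190 [M6K4QF55ʳ ▹ M6K4QF55 ▹ M6K5EB80] (was 181); (6,12) ≥ 215 [M6K5EB80 ▹ M6K5EB80ʳ ▹ M6K4QF55ʳ] (was 203); (6,13) ≥ 240 [M6K5EB80 ▹ M6K5EB80ʳ ▹ M6K5EB80] (was 225). -/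

/-- **`ζ_sym(6,7) ≥ 110`** (`¬ PosRootLawAt 6 7 109`) — the block word `M6K4QF55ʳ ▹ M6K4QF55` = `55 + 55` alternations on
`4 + 4 − 1` letters (junction law for matching junction inertia; kernel value before this file: 106). self-junction of QUADFLAG55 on its (4,2) native end; supersedes mix_6_7 (106). atoms: val-v1x-eng-2 g2 QUADFLAG55 / ENDBOTH80 on the kit-born native NAT27. [folklore] -/
theorem mix_6_7b : ¬ PosRootLawAt 6 7 109 := by
  have h := Chain.not_posRootLawAt_of_certificateT (by norm_num)
      (Chain.chain_append (by norm_num) (Chain.chain_of_block (block_reverse Reflect.AtomM6K4QF55.block))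
        Reflect.AtomM6K4QF55.block (Equiv.refl (Fin 6)) (by intro i; fin_cases i <;> norm_num))
  norm_num at h
  exact h

/-- **`ζ_sym(6,8) ≥ 135`** (`¬ PosRootLawAt 6 8 134`) — the block word `M6K4QF55 ▹ M6K5EB80` = `55 + 80` alternations on
`4 + 5 − 1` letters (junction law for matching junction inertia; kernel value before this file: 128). QUADFLAG55 ▹ ENDBOTH80 on the two inertia-(3,3) flag letters; supersedes mix_6_8 (128). [folklore] -/
theorem mix_6_8b : ¬ PosRootLawAt 6 8 134 := by
  have h := Chain.not_posRootLawAt_of_certificateT (by norm_num)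
      (Chain.chain_append (by norm_num) (Chain.chain_of_block Reflect.AtomM6K4QF55.block)
        Reflect.AtomM6K5EB80.block (Equiv.refl (Fin 6)) (by intro i; fin_cases i <;> norm_num))
  norm_num at h
  exact h

/-- **`ζ_sym(6,11) ≥ 190`** (`¬ PosRootLawAt 6 11 189`) — the block word `M6K4QF55ʳ ▹ M6K4QF55 ▹ M6K5EB80` = `55 + 55 + 80` alternations on
`4 + 4 + 5 − 2` letters (junction law for matching junction inertia; kernel value before this file: 181). supersedes mix_6_11 (181). [folklore] -/
theorem mix_6_11b : ¬ PosRootLawAt 6 11 189 := by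
  have h := Chain.not_posRootLawAt_of_certificateT (by norm_num)
      (Chain.chain_append (by norm_num) (Chain.chain_append (by norm_num) (Chain.chain_of_block (block_reverse Reflect.AtomM6K4QF55.block))
        Reflect.AtomM6K4QF55.block (Equiv.refl (Fin 6)) (by intro i; fin_cases i <;> norm_num))
        Reflect.AtomM6K5EB80.block (Equiv.refl (Fin 6)) (by intro i; fin_cases i <;> norm_num))
  norm_num at h
  exact h

/-- **`ζ_sym(6,12) ≥ 215`** (`¬ PosRootLawAt 6 12 214`) — the block word `M6K5EB80 ▹ M6K5EB80ʳ ▹ M6K4QF55ʳ` = `80 + 80 + 55` alternations on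
`5 + 5 + 4 − 2` letters (junction law for matching junction inertia; kernel value before this file: 203). supersedes mix_6_12 (203). [folklore] -/
theorem mix_6_12b : ¬ PosRootLawAt 6 12 214 := by
  have h := Chain.not_posRootLawAt_of_certificateT (by norm_num)
      (Chain.chain_append (by norm_num) (Chain.chain_append (by norm_num) (Chain.chain_of_block Reflect.AtomM6K5EB80.block)
        (block_reverse Reflect.AtomM6K5EB80.block) (Equiv.refl (Fin 6)) (by intro i; fin_cases i <;> norm_num))
        (block_reverse Reflect.AtomM6K4QF55.block) (Equiv.refl (Fin 6)) (by intro i; fin_cases i <;> norm_num))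
  norm_num at h
  exact h

/-- **`ζ_sym(6,13) ≥ 240`** (`¬ PosRootLawAt 6 13 239`) — the block word `M6K5EB80 ▹ M6K5EB80ʳ ▹ M6K5EB80` = `80 + 80 + 80` alternations on
`5 + 5 + 5 − 2` letters (junction law for matching junction inertia; kernel value before this file: 225). supersedes mix_6_13 (225). [folklore] -/
theorem mix_6_13b : ¬ PosRootLawAt 6 13 239 := by
  have h := Chain.not_posRootLawAt_of_certificateT (by norm_num)
      (Chain.chain_append (by norm_num) (Chain.chain_append (by norm_num) (Chain.chain_of_block Reflect.AtomM6K5EB80.block)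
        (block_reverse Reflect.AtomM6K5EB80.block) (Equiv.refl (Fin 6)) (by intro i; fin_cases i <;> norm_num))
        Reflect.AtomM6K5EB80.block (Equiv.refl (Fin 6)) (by intro i; fin_cases i <;> norm_num))
  norm_num at h
  exact h

end Summit.ValiantsHypothesis.ValiantsHypothesis.Theorems.LacunarySymmetroidMatrixDescartes.Census.Reflect.MixM6
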